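import Literature.Analysis.Calculus.FlatCubeRootDescentRealKey
import Literature.Analysis.Calculus.FlatZeroSectionValues
import Literature.Analysis.Calculus.BorelCutoffSeriesBanach
import Literature.Analysis.Calculus.TaylorValueFlatParam
import HarnessLib

/-!
# Flat real cube-root descent with parameters, II: the descent theorem and the «mod 3» decomposition

Topic `Analysis/Calculus`.  Context: cell `pub/hodgecm-mathlib`, N8-INNER brick (10)(A) «SPLIT NEWTON `S₂ ⊂ S₃`»
(sigsheet `SIGSHEET-NewtonSplitThree.v1`, file F1, part II).  Count-neutral Literature THEOREMS (`--kind proof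
--supports stmt-HodgeConjecture-24833`); no `def`, no instance, no notation, no `sorry`.  Frame of ★
`FlatCubeRootDescent` (one universe; `P` finite-dimensional; `E` complete where Borel's lemma is used).
* §3 HEADS of the descent: `exists_contDiff_comp_pow_three_of_flat` — a smooth `f : ℝ × P → E` with all
  derivatives vanishing on `{0} × P` is `f (s, y) = G (s³, y)` with `G` smooth on ALL of `ℝ × P` and flat along the
  section (★ part I key estimate + ★ B7 `contDiff_of_iteratedFDeriv_tendsto_zero_zeroSection`); value-flat input
  form `exists_contDiff_comp_pow_three_of_isBigO` (★ `iteratedFDeriv_zeroSection_eq_zero_of_isBigO`).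
* §4 the «MOD 3» DECOMPOSITION `exists_sum_pow_smul_comp_pow_three`: EVERY smooth `r : ℝ × P → E` is
  `r (t, y) = Σ_{k<3} t^k • ρ_k (t³, y)` with `ρ₀, ρ₁, ρ₂` smooth — Borel's lemma (★ `BorelCutoffSeriesBanach`)
  realises the three residue classes mod 3 of the `t`-Taylor series of `r` as smooth functions of `σ = t³`, the rest
  is flat along `t = 0` (★ `TaylorValueFlatParam.isBigO_sub_taylorSum_fst`) and descends by §3.  This is the
  one-variable engine of the «formal + flat ALONG THE AXIS» road to the split smooth Newton theorem (files F2
  `NewtonSplitThreeFormal`, F3 `NewtonSplitThree`): it is the smooth preparation theorem for `t ↦ t³`.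
HONEST LABEL: count-neutral Mathlib-side analysis; HC_CM is proved only modulo the printed citations (hLiu418 =
`stmt-HodgeConjecture-24832`, h413 = `stmt-HodgeConjecture-24833`) until rung 0 closes.

## References
* [Whitney1943] H. Whitney, *Differentiable even functions*, Duke Math. J. 10 (1943) 159–160, Thm. 1.
* [HormanderALPDO1] L. Hörmander, *The Analysis of Linear Partial Differential Operators I*, §1.1 (1.1.7)–(1.1.8),
  §1.2 Thm. 1.2.6 (Borel).
-/

noncomputable section

open Set Function Filter Metric Topology Asymptotics
open scoped ContDiff Nat

namespace Literature.Analysis.Calculus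

universe u

/-! ## §3 Heads: flat real cube-root descent -/

section Main

variable {P : Type u} [NormedAddCommGroup P] [NormedSpace ℝ P] [FiniteDimensional ℝ P]
  {E : Type u} [NormedAddCommGroup E] [NormedSpace ℝ E]

/-- **Flat real cube-root descent with parameters.** A smooth `f : ℝ × P → E` with ALL derivatives vanishing on the
zero section `{0} × P` is a smooth function of `(s³, y)`: `f (s, y) = G (s³, y)` with `G` smooth on all of `ℝ × P`
and again flat along `{0} × P`. [folklore] [cite: Whitney1943, Thm. 1] [cite: HormanderALPDO1, §1.1 (1.1.7)–(1.1.8)] -/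
theorem exists_contDiff_comp_pow_three_of_flat (f : ℝ × P → E) (hf : ContDiff ℝ ∞ f)
    (hflat : ∀ (n : ℕ) (y : P), iteratedFDeriv ℝ n f (0, y) = 0) :
    ∃ G : ℝ × P → E, ContDiff ℝ ∞ G ∧ (∀ (n : ℕ) (y : P), iteratedFDeriv ℝ n G (0, y) = 0) ∧
      ∀ (s : ℝ) (y : P), f (s, y) = G (s ^ 3, y) := by
  obtain ⟨K, hK⟩ := exists_comp_pow_three_eq f
  have h0 : ∀ y : P, K (0, y) = 0 := by
    intro y
    have h1 : f (0, y) = K (0, y) := by simpa using hK 0 y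
    rw [← h1, ← norm_eq_zero, ← norm_iteratedFDeriv_zero (𝕜 := ℝ), hflat 0 y, norm_zero]
  obtain ⟨hKs, hKflat⟩ := contDiff_of_iteratedFDeriv_tendsto_zero_zeroSection
    (contDiffOn_of_comp_pow_three_eq f hf K hK) h0
    (tendsto_iteratedFDeriv_of_comp_pow_three_eq f hf hflat K hK)
  exact ⟨K, hKs, hKflat, hK⟩

/-- **Flat real cube-root descent, value-flat input.** The same with the flatness hypothesis in the value currency
`f = O(|s| ^ N)` near every section point (★ `iteratedFDeriv_zeroSection_eq_zero_of_isBigO`). [folklore]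
[cite: Whitney1943, Thm. 1] [cite: HormanderALPDO1, §1.1 (1.1.7)–(1.1.8)] -/
theorem exists_contDiff_comp_pow_three_of_isBigO (f : ℝ × P → E) (hf : ContDiff ℝ ∞ f)
    (hO : ∀ (N : ℕ) (y : P), f =O[𝓝 ((0 : ℝ), y)] fun q : ℝ × P => ‖q.1‖ ^ N) :
    ∃ G : ℝ × P → E, ContDiff ℝ ∞ G ∧ (∀ (n : ℕ) (y : P), iteratedFDeriv ℝ n G (0, y) = 0) ∧
      ∀ (s : ℝ) (y : P), f (s, y) = G (s ^ 3, y) :=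
  exists_contDiff_comp_pow_three_of_flat f hf (iteratedFDeriv_zeroSection_eq_zero_of_isBigO f hf hO)

end Main

/-! ## §4 The «mod 3» decomposition of a smooth function of one real variable (with parameters) -/

section ModThree

variable {P : Type u} [NormedAddCommGroup P] [NormedSpace ℝ P] [FiniteDimensional ℝ P]
  {E : Type u} [NormedAddCommGroup E] [NormedSpace ℝ E] [CompleteSpace E]

/-- Regrouping a finite Taylor sum by residues mod 3:
`Σ_{j ≤ 3M+2} aⱼ = Σ_{k<3} Σ_{i ≤ M} a_{3i+k}`. [folklore] [cite: HormanderALPDO1, §1.1 (1.1.7)] -/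
theorem sum_range_three_mul_add_three_eq {M' : Type*} [AddCommMonoid M'] (a : ℕ → M') (M : ℕ) :
    ∑ j ∈ Finset.range (3 * M + 3), a j =
      ∑ k ∈ Finset.range 3, ∑ i ∈ Finset.range (M + 1), a (3 * i + k) := by
  induction M with
  | zero => simp [Finset.sum_range_succ]
  | succ M ih =>
    have h : 3 * (M + 1) + 3 = (3 * M + 3) + 1 + 1 + 1 := by ring
    rw [h, Finset.sum_range_succ, Finset.sum_range_succ, Finset.sum_range_succ, ih]
    simp only [Finset.sum_range_succ _ (M + 1)]
    rw [Finset.sum_add_distrib]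
    simp only [Finset.sum_range_succ, Finset.sum_range_zero, zero_add]
    have e0 : 3 * (M + 1) + 0 = 3 * M + 3 := by ring
    have e1 : 3 * (M + 1) + 1 = 3 * M + 3 + 1 := by ring
    have e2 : 3 * (M + 1) + 2 = 3 * M + 3 + 1 + 1 := by ring
    rw [e0, e1, e2]
    abel

/-- **The «mod 3» decomposition.** Every smooth `r : ℝ × P → E` (`E` complete, `P` finite-dimensional) can be written
`r (t, y) = Σ_{k<3} t ^ k • ρ_k (t³, y)` with `ρ₀, ρ₁, ρ₂` smooth on all of `ℝ × P`.  Proof: Borel's lemma realises,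
for each residue `k`, a smooth `β_k (σ, y)` with `∂_σ^i β_k (0, y) = ((3i+k)! )⁻¹ i! • ∂_t^{3i+k} r (0, y)`; then
`r (t, y) − Σ_k t^k • β_k (t³, y)` is flat along `t = 0` (one-variable Taylor in `t` for `r` and in `σ` for each `β_k`),
hence equals `γ (t³, y)` with `γ` smooth (flat cube-root descent, §3); take `ρ₀ := β₀ + γ`, `ρ₁ := β₁`, `ρ₂ := β₂`.
[folklore] [cite: Whitney1943, Thm. 1] [cite: HormanderALPDO1, §1.2 Thm. 1.2.6; §1.1 (1.1.7)–(1.1.8)] -/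
theorem exists_sum_pow_smul_comp_pow_three (r : ℝ × P → E) (hr : ContDiff ℝ ∞ r) :
    ∃ ρ : Fin 3 → ℝ × P → E, (∀ k, ContDiff ℝ ∞ (ρ k)) ∧
      ∀ (t : ℝ) (y : P), r (t, y) = ∑ k : Fin 3, t ^ (k : ℕ) • ρ k (t ^ 3, y) := by
  -- Taylor coefficients of `r` in `t`, smooth in `y`
  set a : ℕ → P → E := fun j y => iteratedDeriv j (fun s => r (s, y)) 0 with ha
  have ha_smooth : ∀ j, ContDiff ℝ ∞ (a j) := fun j => contDiff_iteratedDeriv_slice_fst_zero hr j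
  -- Borel data for the residue class `k`: `∂_σ^i β_k (0, y) = (i! / (3i+k)!) • a (3i+k) y`
  set b : Fin 3 → ℕ → P → E := fun k i y => ((i ! : ℝ) / ((3 * i + (k : ℕ)) ! : ℝ)) • a (3 * i + k) y
    with hb
  have hb_smooth : ∀ k i, ContDiff ℝ ∞ (b k i) := fun k i => contDiff_const.smul (ha_smooth _)
  have hβ : ∀ k : Fin 3, ∃ β : ℝ × P → E, ContDiff ℝ ∞ β ∧
      ∀ (y : P) (i : ℕ), iteratedDeriv i (fun σ => β (σ, y)) 0 = b k i y :=
    fun k => exists_contDiff_iteratedDeriv_zeroSection_eq_of_finiteDimensional (b k) (hb_smooth k)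
  choose β hβs hβj using hβ
  -- the remainder `R (t, y) := r (t, y) − Σ_k t^k • β_k (t³, y)` is smooth and value-flat along `t = 0`
  set R : ℝ × P → E := fun q => r q - ∑ k : Fin 3, q.1 ^ (k : ℕ) • β k (q.1 ^ 3, q.2) with hR
  have hRs : ContDiff ℝ ∞ R := by
    refine hr.sub (ContDiff.sum fun k _ => (contDiff_fst.pow _).smul ?_)
    exact (hβs k).comp ((contDiff_fst.pow 3).prodMk contDiff_snd)
  have hRflat : ∀ (N : ℕ) (y₀ : P), R =O[𝓝 ((0 : ℝ), y₀)] fun q : ℝ × P => ‖q.1‖ ^ N := by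
    intro N y₀
    -- it suffices to prove the bound at an order `3M + 3 > N`
    obtain ⟨M, hM⟩ : ∃ M : ℕ, N ≤ 3 * M + 3 := ⟨N, by omega⟩
    -- (a) Taylor for `r` in `t` at order `3M + 2`
    have hT := isBigO_sub_taylorSum_fst r hr y₀ (3 * M + 2)
    -- (b) Taylor for each `β_k` in `σ` at order `M`, transported along `σ = t³`
    have hβT : ∀ k : Fin 3, (fun q : ℝ × P => q.1 ^ (k : ℕ) • (β k (q.1 ^ 3, q.2) -
        ∑ i ∈ Finset.range (M + 1), ((q.1 ^ 3) ^ i / (i ! : ℝ)) • b k i q.2))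
          =O[𝓝 ((0 : ℝ), y₀)] fun q : ℝ × P => ‖q.1‖ ^ (3 * M + 3) := by
      intro k
      have h1 := isBigO_sub_taylorSum_fst (β k) (hβs k) y₀ M
      -- transport along `φ (t, y) = (t³, y)`, continuous and fixing `(0, y₀)`
      have hφ : Tendsto (fun q : ℝ × P => (q.1 ^ 3, q.2)) (𝓝 ((0 : ℝ), y₀)) (𝓝 ((0 : ℝ), y₀)) := by
        have hc : Continuous fun q : ℝ × P => (q.1 ^ 3, q.2) := by fun_prop
        simpa using hc.tendsto ((0 : ℝ), y₀)
      have h2 := h1.comp_tendsto hφ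
      have h3 : (fun q : ℝ × P => β k (q.1 ^ 3, q.2) -
          ∑ i ∈ Finset.range (M + 1), ((q.1 ^ 3) ^ i / (i ! : ℝ)) • b k i q.2)
            =O[𝓝 ((0 : ℝ), y₀)] fun q : ℝ × P => ‖q.1‖ ^ (3 * M + 3) := by
        refine (h2.congr_left fun q => ?_).trans ?_
        · simp only [Function.comp_apply, hβj]
        · refine IsBigO.of_bound 1 (Eventually.of_forall fun q => ?_)
          simp only [Function.comp_apply, one_mul]
          rw [Real.norm_of_nonneg (pow_nonneg (abs_nonneg _) _),
            Real.norm_of_nonneg (pow_nonneg (norm_nonneg _) _), abs_pow, ← pow_mul,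
            Real.norm_eq_abs]
          apply le_of_eq; ring_nf
      -- the factor `t ^ k` is bounded by `1` near `t = 0`
      have hk1 : ∀ᶠ q : ℝ × P in 𝓝 ((0 : ℝ), y₀), ‖q.1 ^ (k : ℕ)‖ ≤ 1 := by
        have : Metric.ball ((0 : ℝ), y₀) 1 ∈ 𝓝 ((0 : ℝ), y₀) := Metric.ball_mem_nhds _ one_pos
        filter_upwards [this] with q hq
        rw [Metric.mem_ball, Prod.dist_eq, max_lt_iff, dist_zero_right] at hq
        rw [norm_pow]
        exact pow_le_one₀ (norm_nonneg _) hq.1.le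
      have h4 : (fun q : ℝ × P => q.1 ^ (k : ℕ)) =O[𝓝 ((0 : ℝ), y₀)] fun _ : ℝ × P => (1 : ℝ) :=
        IsBigO.of_bound 1 (by simpa using hk1)
      have := h4.smul h3
      simpa only [smul_eq_mul, one_mul] using this
    -- (c) the two Taylor polynomials coincide: regroup the `t`-Taylor sum of `r` mod 3
    have hpoly : ∀ q : ℝ × P, ∑ j ∈ Finset.range (3 * M + 2 + 1),
        (q.1 ^ j / (j ! : ℝ)) • iteratedDeriv j (fun s => r (s, q.2)) 0 =
          ∑ k : Fin 3, q.1 ^ (k : ℕ) • ∑ i ∈ Finset.range (M + 1),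
            ((q.1 ^ 3) ^ i / (i ! : ℝ)) • b k i q.2 := by
      intro q
      have h := sum_range_three_mul_add_three_eq
        (fun j => (q.1 ^ j / (j ! : ℝ)) • iteratedDeriv j (fun s => r (s, q.2)) 0) M
      rw [show 3 * M + 2 + 1 = 3 * M + 3 by ring, h, Finset.sum_range, Fin.sum_univ_three,
        Fin.sum_univ_three]
      simp only [Fin.val_zero, Fin.val_one, Fin.val_two, hb, ha, Finset.smul_sum, smul_smul]
      refine congrArg₂ (· + ·) (congrArg₂ (· + ·) ?_ ?_) ?_ <;>
        refine Finset.sum_congr rfl fun i _ => ?_ <;> congr 1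
      · have hne : ((3 * i + 0) ! : ℝ) ≠ 0 := by positivity
        have hne' : (i ! : ℝ) ≠ 0 := by positivity
        field_simp
        ring
      · have hne : ((3 * i + 1) ! : ℝ) ≠ 0 := by positivity
        have hne' : (i ! : ℝ) ≠ 0 := by positivity
        field_simp
        ring
      · have hne : ((3 * i + 2) ! : ℝ) ≠ 0 := by positivity
        have hne' : (i ! : ℝ) ≠ 0 := by positivity
        field_simp
        ring
    -- (d) assemble
    have hsum := IsBigO.sum (s := (Finset.univ : Finset (Fin 3))) fun k _ => hβT k
    have hmain : R =O[𝓝 ((0 : ℝ), y₀)] fun q : ℝ × P => ‖q.1‖ ^ (3 * M + 3) := by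
      have hT' : (fun q : ℝ × P => r q - ∑ j ∈ Finset.range (3 * M + 2 + 1),
          (q.1 ^ j / (j ! : ℝ)) • iteratedDeriv j (fun s => r (s, q.2)) 0)
            =O[𝓝 ((0 : ℝ), y₀)] fun q : ℝ × P => ‖q.1‖ ^ (3 * M + 3) := by
        refine hT.trans (IsBigO.of_bound 1 (Eventually.of_forall fun q => ?_))
        rw [one_mul, Real.norm_of_nonneg (pow_nonneg (abs_nonneg _) _),
          Real.norm_of_nonneg (pow_nonneg (norm_nonneg _) _), Real.norm_eq_abs]
      refine (hT'.sub hsum).congr_left fun q => ?_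
      simp only [hR, hpoly, Finset.smul_sum, smul_sub, Finset.sum_sub_distrib]
      abel
    refine hmain.trans (IsBigO.of_bound 1 ?_)
    have hball : ∀ᶠ q : ℝ × P in 𝓝 ((0 : ℝ), y₀), ‖q.1‖ ≤ 1 := by
      have : Metric.ball ((0 : ℝ), y₀) 1 ∈ 𝓝 ((0 : ℝ), y₀) := Metric.ball_mem_nhds _ one_pos
      filter_upwards [this] with q hq
      rw [Metric.mem_ball, Prod.dist_eq, max_lt_iff, dist_zero_right] at hq
      exact hq.1.le
    filter_upwards [hball] with q hq
    rw [one_mul, Real.norm_of_nonneg (pow_nonneg (norm_nonneg _) _),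
      Real.norm_of_nonneg (pow_nonneg (norm_nonneg _) _)]
    exact pow_le_pow_of_le_one (norm_nonneg _) hq hM
  -- flat descent of the remainder
  obtain ⟨γ, hγs, -, hγ⟩ := exists_contDiff_comp_pow_three_of_isBigO R hRs hRflat
  refine ⟨fun k => if (k : ℕ) = 0 then (fun q => β 0 q + γ q) else β k, fun k => ?_, fun t y => ?_⟩
  · fin_cases k
    · simpa using (hβs 0).add hγs
    · simpa using hβs 1
    · simpa using hβs 2
  · have h := hγ t y
    simp only [hR] at h
    rw [Fin.sum_univ_three] at h ⊢
    simp only [Fin.isValue, Fin.val_zero, pow_zero, one_smul, Fin.val_one, pow_one, Fin.val_two,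
      ↓reduceIte, Nat.one_ne_zero, OfNat.ofNat_ne_zero, smul_add] at h ⊢
    rw [← h]
    abel

end ModThree

end Literature.Analysis.Calculus

end
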